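import Summits.AtomisticToContinuum.HydrodynamicLimit.Theses.BoxDissipativeWeakStrong
import Summits.AtomisticToContinuum.HydrodynamicLimit.Theorems.BoxDissipativeWeakStrongDefs
import Summits.AtomisticToContinuum.HydrodynamicLimit.Theorems.BoxDissipativeWeakStrongEntropyAdmissibilityStubConcentrationOfPTBCA
import Literature.Analysis.FluidPDE.HardSphereFlowJointMeasurable
import Literature.MathematicalPhysics.KineticTheory.HardSphereBBGKYLiouvilleFlow

/-!
# Crux `EntropyAdmissibility` (stmt-AtomisticToContinuum-9903), line `registered` — stub `stub_entropyBalanceConcentration_of_PTBC`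

Registered stub S2b of the line `registered` of the crux
`Summit.AtomisticToContinuum.HydrodynamicLimit.Theses.BoxDissipativeWeakStrong.EntropyAdmissibility`:
**S2a → S2**, i.e. the positive-time box concentration of linear-growth Borel functionals of the box fields
(`Sig.stub_positiveTimeBoxConcentration`, hypothesis) implies that the DYNAMIC part
`A_N = ∫_{(0,τ]}∫(ρ̂ Z_{a,b}(ŝ) ∂ₜφ + Z_{a,b}(ŝ) m̂·∇φ) dx dt − ∫ ρ̂_τ Z_{a,b}(ŝ_τ) φ_τ dx` of the
clamp-renormalised entropy balance concentrates at its Bochner mean in `L¹(P_N)`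
(`Sig.stub_entropyBalanceConcentration`). Proof (measure theory only; file B of two, toolbox `EABirthS2bA`):
* the flow is regularised to the identity off its conull good set (`gflow`: jointly measurable in `(t, z)`,
  `HardSphereFlow.measurable_flow_prod_torus`; energy preserving EVERYWHERE, `HardSphereFlow.configEnergy_flow`),
  which changes `A_N` and the box functionals only on a `P_N`-null set (`P_N ≪ Liouville`);
* the integrands are `M G₁(Û) ∂ₜφ + Σ_k M G₂ₖ(Û) ∂ₖφ` and `M G₁(Û_τ) φ_τ` with the Borel linear-growth functionals
  `G₁(r,m,e) = r Z_{a,b}(s_cut(r⁺, θ̂(r⁺,m,e)))/M`, `G₂ₖ = Z_{a,b}(…) m_k/M`, `M = |a| ∨ |b|` (`r⁺ = max r 0 = ρ̂` on box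
  fields; `f_ex` is only evaluated on `[0, η₁] ⊆ [0, η₀)`, `ηc := η₀` of `HsEosLowDensity`), so S2a at each fixed
  `t ∈ (0, τ]` and at `τ`, with the continuous slices `∂ₜφ(t,·)`, `∂ₖφ(t,·)`, `φ(τ,·)`, gives concentration of the
  space integrals at fixed time (sums and constant multiples of concentrating integrable sequences);
* the time integral concentrates by `EABirthS2bA.tendsto_conc_integral` (Tonelli on `P_N ⊗ dt|_{(0,τ]}`, dominated
  convergence in `t`) thanks to the `N`-UNIFORM bound `|∫ bulk dx| ≤ C + D (N+1)⁻¹Σ‖vᵢ‖²` (`∫ ρ̂ dx = 1`,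
  `∫ ‖m̂‖ dx ≤ (N+1)⁻¹Σ‖vᵢ‖`, energy conservation) and the Maxwellian bound `E_{P_N}[(N+1)⁻¹Σ‖vᵢ‖²] ≤ K`;
  `σ₀ := σ₀(S2a) ∧ 1/2`.

References: J. Březina, E. Feireisl, J. Math. Soc. Japan 70 (2018), Def. 2.9, §3.2; H. Spohn, *Large Scale Dynamics of
Interacting Particles* (1991), Part I Ch. 3. prover-line-stmt-AtomisticToContinuum-9903-0 (worker S2b).
-/

noncomputable section

open MeasureTheory Filter Set
open scoped ENNReal Topology


namespace Summit.AtomisticToContinuum.HydrodynamicLimit.Theorems.EABirthS2b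

open Literature.MathematicalPhysics.KineticTheory
open Literature.Analysis.FluidPDE.CompressibleEuler (clamp)
open Summit.AtomisticToContinuum.HydrodynamicLimit.Theses
open Summit.AtomisticToContinuum.HydrodynamicLimit.Theorems.BDWS
open Literature.Analysis.FluidPDE (Config configEnergy HardSphereFlow)
open Literature.Analysis.FunctionSpaces
open EABirthS1a (statEntropy statBulk statBdry)
open EABirthS2bA

/-! ## The flow regularised off its good set -/

section GFlow

variable {n : ℕ} {ε : ℝ}

open scoped Classical in
/-- The hard-sphere flow with its junk values off the good set replaced by the identity. -/
def gflow (Φ : HardSphereFlow (Literature.Analysis.FluidPDE.Torus.geometry (Fin 3)) ε n) (t : ℝ)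
    (z : Config n (Fin 3) T3) : Config n (Fin 3) T3 :=
  if z ∈ Φ.good then Φ.flow t z else z

variable (Φ : HardSphereFlow (Literature.Analysis.FluidPDE.Torus.geometry (Fin 3)) ε n)

/-- On the good set the regularised flow is the flow. -/
theorem gflow_of_mem {z : Config n (Fin 3) T3} (hz : z ∈ Φ.good) (t : ℝ) : gflow Φ t z = Φ.flow t z := by
  simp [gflow, hz]

/-- Off the good set the regularised flow is the identity. -/
theorem gflow_of_not_mem {z : Config n (Fin 3) T3} (hz : z ∉ Φ.good) (t : ℝ) : gflow Φ t z = z := by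
  simp [gflow, hz]

/-- The regularised flow preserves `Σ ‖vᵢ‖²` everywhere (energy conservation on the good set). -/
theorem sum_norm_sq_gflow (t : ℝ) (z : Config n (Fin 3) T3) :
    ∑ i, ‖(gflow Φ t z i).2‖ ^ 2 = ∑ i, ‖(z i).2‖ ^ 2 := by
  by_cases hz : z ∈ Φ.good
  · have h := Φ.configEnergy_flow hz t
    simp only [configEnergy] at h
    rw [gflow_of_mem Φ hz]
    linarith
  · rw [gflow_of_not_mem Φ hz]

/-- The regularised flow is jointly measurable in `(t, z)`. -/
theorem measurable_gflow : Measurable fun p : ℝ × Config n (Fin 3) T3 => gflow Φ p.1 p.2 := by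
  refine measurable_of_restrict_of_restrict_compl (s := {p : ℝ × Config n (Fin 3) T3 | p.2 ∈ Φ.good})
    (measurable_snd Φ.measurableSet_good) ?_ ?_
  · rw [show ({p : ℝ × Config n (Fin 3) T3 | p.2 ∈ Φ.good}.restrict fun p => gflow Φ p.1 p.2) =
        (fun q : Φ.good × ℝ => Φ.flow q.2 (q.1 : Config n (Fin 3) T3)) ∘ fun p => (⟨p.1.2, p.2⟩, p.1.1) from
      funext fun p => gflow_of_mem Φ p.2 _]
    exact Φ.measurable_flow_prod_torus.comp (((measurable_snd.comp measurable_subtype_coe).subtype_mk).prodMk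
      (measurable_fst.comp measurable_subtype_coe))
  · rw [show ({p : ℝ × Config n (Fin 3) T3 | p.2 ∈ Φ.good}ᶜ.restrict fun p => gflow Φ p.1 p.2) = fun p => p.1.2 from
      funext fun p => gflow_of_not_mem Φ p.2 _]
    exact measurable_snd.comp measurable_subtype_coe

/-- For a law carried by the good set, the regularised flow is the flow almost surely, at all times. -/
theorem gflow_ae_eq {μ : Measure (Config n (Fin 3) T3)} (hμ : μ Φ.goodᶜ = 0) :
    ∀ᵐ z ∂μ, ∀ t, gflow Φ t z = Φ.flow t z := by
  have h : ∀ᵐ z ∂μ, z ∈ Φ.good := by rw [ae_iff]; exact hμ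
  exact h.mono fun z hz t => gflow_of_mem Φ hz t

end GFlow

/-! ## The linear-growth integrands -/

section Integrands

variable {N : ℕ} {η₀ σ η₁ a b : ℝ}

/-- `Z_{a,b}(s_cut(r⁺, θ̂(r⁺, m, e)))`, `r⁺ = max r 0`. -/
def entG (σ η₁ a b : ℝ) (p : ℝ × V3 × ℝ) : ℝ :=
  clamp a b (cutEntropy σ η₁ (max p.1 0) (boxTemp (max p.1 0) p.2.1 p.2.2))

/-- `G₁(r, m, e) = r Z(…) / M`. -/
def densG (σ η₁ a b : ℝ) (p : ℝ × V3 × ℝ) : ℝ := p.1 * entG σ η₁ a b p / max |a| |b|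

/-- `G₂ₖ(r, m, e) = Z(…) m_k / M`. -/
def momG (σ η₁ a b : ℝ) (k : Fin 3) (p : ℝ × V3 × ℝ) : ℝ := entG σ η₁ a b p * p.2.1 k / max |a| |b|

/-- `0 < M = |a| ∨ |b|` for `a < b`. -/
theorem max_abs_pos (hab : a < b) : 0 < max |a| |b| := by
  rcases eq_or_ne b 0 with rfl | hb
  · exact lt_max_of_lt_left (abs_pos.2 hab.ne)
  · exact lt_max_of_lt_right (abs_pos.2 hb)

/-- `entG` is Borel (the excess free energy is only evaluated on `[0, η₁] ⊆ [0, η₀)`). -/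
theorem measurable_entG (hcont : ContinuousOn hsExcessFreeEnergy (Ico 0 η₀)) (hσ : 0 ≤ σ) (hη₁ : 0 ≤ η₁)
    (hη₁c : η₁ < η₀) (a b : ℝ) : Measurable (entG σ η₁ a b) := by
  have hr : Measurable fun p : ℝ × V3 × ℝ => max p.1 0 := measurable_fst.max measurable_const
  exact EABirthS0b.measurable_clamp_cutEntropy hr (EABirthS0b.measurable_boxTemp hr
    (measurable_fst.comp measurable_snd) (measurable_snd.comp measurable_snd)) (fun p => le_max_right _ _)
    hcont hσ hη₁ hη₁c a b

/-- `G₁`, `G₂ₖ` are Borel. -/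
theorem measurable_densG_momG (hZ : Measurable (entG σ η₁ a b)) (k : Fin 3) :
    Measurable (densG σ η₁ a b) ∧ Measurable (momG σ η₁ a b k) :=
  ⟨(measurable_fst.mul hZ).div_const _,
    (hZ.mul ((show Measurable fun m : V3 => m k by fun_prop).comp (measurable_fst.comp measurable_snd))).div_const _⟩

/-- Linear growth: `|G₁ p| ≤ |r| + ‖m‖` and `|G₂ₖ p| ≤ |r| + ‖m‖`. -/
theorem abs_densG_momG_le (hab : a < b) (k : Fin 3) (p : ℝ × V3 × ℝ) :
    |densG σ η₁ a b p| ≤ |p.1| + ‖p.2.1‖ ∧ |momG σ η₁ a b k p| ≤ |p.1| + ‖p.2.1‖ := by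
  have hM := max_abs_pos hab
  have hZ : |entG σ η₁ a b p| ≤ max |a| |b| := Literature.Analysis.FluidPDE.CompressibleEuler.abs_clamp_le hab.le _
  have hk : |p.2.1 k| ≤ ‖p.2.1‖ := by simpa using PiLp.norm_apply_le p.2.1 k
  refine ⟨?_, ?_⟩
  · rw [densG, abs_div, abs_mul, abs_of_pos hM, div_le_iff₀ hM]
    calc |p.1| * |entG σ η₁ a b p| ≤ |p.1| * max |a| |b| := mul_le_mul_of_nonneg_left hZ (abs_nonneg _)
      _ ≤ (|p.1| + ‖p.2.1‖) * max |a| |b| := by nlinarith [norm_nonneg p.2.1]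
  · rw [momG, abs_div, abs_mul, abs_of_pos hM, div_le_iff₀ hM]
    calc |entG σ η₁ a b p| * |p.2.1 k| ≤ max |a| |b| * ‖p.2.1‖ := mul_le_mul hZ hk (abs_nonneg _) hM.le
      _ ≤ (|p.1| + ‖p.2.1‖) * max |a| |b| := by nlinarith [abs_nonneg p.1, norm_nonneg p.2.1]

/-- **The bulk integrand through `G₁`, `G₂ₖ`**: `statBulk = M G₁(Û) ψ₁ + Σ_k M G₂ₖ(Û) (ψ₂)_k` pointwise. -/
theorem statBulk_eq (hab : a < b) {l : ℝ} (hl : 0 ≤ l) (ψ₁ : ℝ → T3 → ℝ) (ψ₂ : ℝ → T3 → V3) (t : ℝ)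
    (w : Config (N + 1) (Fin 3) T3) (x : T3) :
    statBulk σ η₁ l a b ψ₁ ψ₂ t w x = max |a| |b| * (densG σ η₁ a b (fields l w x) * ψ₁ t x) +
      ∑ k, max |a| |b| * (momG σ η₁ a b k (fields l w x) * ψ₂ t x k) := by
  have hM := (max_abs_pos hab).ne'
  have hZ : entG σ η₁ a b (fields l w x) = statEntropy σ η₁ l a b w x := by
    simp only [entG, fields, EABirthS1a.statEntropy, max_eq_left (density_nonneg hl w x)]
  have hin : inner ℝ (empiricalMomentumField w (boxKernel l x)) (ψ₂ t x) =
      ∑ k, empiricalMomentumField w (boxKernel l x) k * ψ₂ t x k := by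
    rw [PiLp.inner_apply]; simp [mul_comm]
  simp only [EABirthS1a.statBulk, densG, momG, hZ, hin, Finset.mul_sum]
  congr 1
  · simp only [fields]; field_simp
  · exact Finset.sum_congr rfl fun k _ => by simp only [fields]; field_simp

/-- **The boundary integrand through `G₁`**: `statBdry = M G₁(Û) χ` pointwise. -/
theorem statBdry_eq (hab : a < b) {l : ℝ} (hl : 0 ≤ l) (χ : T3 → ℝ) (w : Config (N + 1) (Fin 3) T3) (x : T3) :
    statBdry σ η₁ l a b χ w x = max |a| |b| * (densG σ η₁ a b (fields l w x) * χ x) := by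
  have hM := (max_abs_pos hab).ne'
  have hZ : entG σ η₁ a b (fields l w x) = statEntropy σ η₁ l a b w x := by
    simp only [entG, fields, EABirthS1a.statEntropy, max_eq_left (density_nonneg hl w x)]
  simp only [EABirthS1a.statBdry, densG, hZ]
  simp only [fields]
  field_simp

/-- A linear-growth Borel functional of the box fields times a continuous test function is integrable in `x`. -/
theorem integrable_growth {G : ℝ × V3 × ℝ → ℝ} (hG : Measurable G) (hgr : ∀ p, |G p| ≤ |p.1| + ‖p.2.1‖)
    {ψ : T3 → ℝ} (hψ : Continuous ψ) {l : ℝ} (hl : 0 ≤ l) (w : Config (N + 1) (Fin 3) T3) :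
    Integrable fun x => G (fields l w x) * ψ x := by
  obtain ⟨D, -, hD⟩ := exists_forall_abs_le_of_continuous hψ
  have hi := integrable_fields hl w
  refine (((hi.1.add hi.2.1.norm)).mul_const D).mono' ((hG.comp (measurable_fields l w)).mul hψ.measurable).aestronglyMeasurable
    (Eventually.of_forall fun x => ?_)
  rw [norm_mul, Real.norm_eq_abs, Real.norm_eq_abs]
  refine mul_le_mul ((hgr _).trans (le_of_eq ?_)) (hD x) (abs_nonneg _)
    (add_nonneg (density_nonneg hl w x) (norm_nonneg _))
  rw [show (fields l w x).1 = empiricalDensityField w (boxKernel l x) from rfl, abs_of_nonneg (density_nonneg hl w x)]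
  rfl

end Integrands

/-! ## Fixed-time concentration along the regularised flow -/

section Frame

variable {σ T : ℝ} {a₀ θ₀ : T3 → ℝ} {u₀ : T3 → V3} {Φ : FlowFamily σ} {ℓ : ℕ → ℝ} {K : ℝ}

/-- **Transfer of S2a to the regularised flow, with integrability.** If the box functional
`z ↦ ∫ G(Û(Φ_t z, x)) ψ(x) dx` concentrates (S2a at `t`, `G`, `ψ`), then so does `z ↦ ∫ G(Û(Ψ_t z, x)) ψ(x) dx` for the
regularised flow `Ψ = gflow`, and the latter is `P_N`-integrable (`|·| ≤ D(3/2 + ½(N+1)⁻¹Σ‖vᵢ‖²)`). -/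
theorem conc_gflow (hP : ∀ N, IsProbabilityMeasure (localGibbsLaw σ a₀ u₀ θ₀ N (Φ N)))
    (hgood : ∀ N, localGibbsLaw σ a₀ u₀ θ₀ N (Φ N) (Φ N).goodᶜ = 0) (hℓ : ∀ N, 0 < ℓ N ∧ ℓ N ≤ 1) (hK : 0 ≤ K)
    (hWK : ∀ N, ∫⁻ z, ENNReal.ofReal (((N : ℝ) + 1)⁻¹ * ∑ i, ‖(z i).2‖ ^ 2) ∂(localGibbsLaw σ a₀ u₀ θ₀ N (Φ N)) ≤
      ENNReal.ofReal K)
    {G : ℝ × V3 × ℝ → ℝ} (hG : Measurable G) (hgr : ∀ p, |G p| ≤ |p.1| + ‖p.2.1‖) {ψ : T3 → ℝ} (hψ : Continuous ψ)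
    (t : ℝ) (hT : Tendsto (fun N : ℕ => ∫⁻ z, ENNReal.ofReal
      |(∫ x, G (boxDensity σ ℓ Φ N t z x, boxMomentum σ ℓ Φ N t z x, boxEnergy σ ℓ Φ N t z x) * ψ x) -
        ∫ z', (∫ x, G (boxDensity σ ℓ Φ N t z' x, boxMomentum σ ℓ Φ N t z' x, boxEnergy σ ℓ Φ N t z' x) * ψ x)
          ∂(localGibbsLaw σ a₀ u₀ θ₀ N (Φ N))| ∂(localGibbsLaw σ a₀ u₀ θ₀ N (Φ N))) atTop (𝓝 0)) :
    (∀ N, Integrable (fun z => ∫ x, G (fields (ℓ N) (gflow (Φ N) t z) x) * ψ x)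
      (localGibbsLaw σ a₀ u₀ θ₀ N (Φ N))) ∧
      Tendsto (fun N : ℕ => ∫⁻ z, ENNReal.ofReal |(∫ x, G (fields (ℓ N) (gflow (Φ N) t z) x) * ψ x) -
        ∫ z', (∫ x, G (fields (ℓ N) (gflow (Φ N) t z') x) * ψ x) ∂(localGibbsLaw σ a₀ u₀ θ₀ N (Φ N))|
          ∂(localGibbsLaw σ a₀ u₀ θ₀ N (Φ N))) atTop (𝓝 0) := by
  obtain ⟨D, -, hD⟩ := exists_forall_abs_le_of_continuous hψ
  refine ⟨fun N => ?_, tendsto_conc_congr_ae (fun N => localGibbsLaw σ a₀ u₀ θ₀ N (Φ N)) (fun N => ?_) hT⟩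
  · haveI := hP N
    have hgt : Measurable (gflow (Φ N) t) := (measurable_gflow (Φ N)).comp (measurable_const.prodMk measurable_id)
    have hm : Measurable fun q : Config (N + 1) (Fin 3) T3 × T3 => G (fields (ℓ N) (gflow (Φ N) t q.1) q.2) * ψ q.2 :=
      (hG.comp ((measurable_fields_uncurry (ℓ N)).comp ((hgt.comp measurable_fst).prodMk measurable_snd))).mul
        (hψ.measurable.comp measurable_snd)
    refine integrable_of_abs_le_affine (C := 3 / 2 * D) (D := D / 2) hm.stronglyMeasurable.integral_prod_right'.aestronglyMeasurable
      (integrable_of_lintegral_ofReal_le (by fun_prop) (fun z => by positivity) hK (hWK N)).1 fun z => ?_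
    rw [← sum_norm_sq_gflow (Φ N) t z]
    exact abs_integral_growth_le (hℓ N).1 (hℓ N).2 hgr (fun x => (Real.norm_eq_abs _).trans_le (hD x)) _
  · filter_upwards [gflow_ae_eq (Φ N) (hgood N)] with z hz
    simp only [boxDensity, boxMomentum, boxEnergy, fields, hz t]

end Frame

/-! ## The stub -/

/-- Signature of the stub S2b: `Sig.stub_positiveTimeBoxConcentration → Sig.stub_entropyBalanceConcentration` of the
lead's skeleton, both bodies inlined verbatim (definitionally the skeleton's statement). -/
def Sig.stub_entropyBalanceConcentration_of_PTBC : Prop :=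
  (∀ (a₀ θ₀ : T3 → ℝ) (u₀ : T3 → V3), Continuous a₀ → Continuous θ₀ → Continuous u₀ →
    (∀ x, 0 < a₀ x) → (∀ x, 0 < θ₀ x) →
    ∃ σ₀ : ℝ, 0 < σ₀ ∧ ∀ σ : ℝ, 0 < σ → σ < σ₀ →
      ∀ (T : ℝ) (ρ θ : ℝ → T3 → ℝ) (u : ℝ → T3 → V3), IsHardSphereEulerSolution σ T ρ u θ →
        ∀ Φ : FlowFamily σ,
          TendstoHydroFieldsAt (fun N => localGibbsLaw σ a₀ u₀ θ₀ N (Φ N)) Φ ρ u θ 0 →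
          ∀ ℓ : ℕ → ℝ, (∀ N, 0 < ℓ N ∧ ℓ N ≤ 1) → Tendsto ℓ atTop (𝓝 0) →
            Tendsto (fun N : ℕ => ℓ N ^ 3 * ((N : ℝ) + 1)) atTop atTop →
            ∀ t ∈ Ico 0 T, ∀ G : ℝ × V3 × ℝ → ℝ, Measurable G → (∀ p, |G p| ≤ |p.1| + ‖p.2.1‖) →
              ∀ ψ : T3 → ℝ, Continuous ψ →
                Tendsto (fun N : ℕ => ∫⁻ z, ENNReal.ofReal
                    |(∫ x, G (boxDensity σ ℓ Φ N t z x, boxMomentum σ ℓ Φ N t z x,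
                        boxEnergy σ ℓ Φ N t z x) * ψ x) -
                      ∫ z', (∫ x, G (boxDensity σ ℓ Φ N t z' x, boxMomentum σ ℓ Φ N t z' x,
                        boxEnergy σ ℓ Φ N t z' x) * ψ x) ∂(localGibbsLaw σ a₀ u₀ θ₀ N (Φ N))|
                  ∂(localGibbsLaw σ a₀ u₀ θ₀ N (Φ N))) atTop (𝓝 0)) →
      (BoxDissipativeWeakStrong.HsEosLowDensity →
    ∃ ηc : ℝ, 0 < ηc ∧ ∀ η₁ : ℝ, 0 < η₁ → η₁ < ηc →
      ∀ (a₀ θ₀ : T3 → ℝ) (u₀ : T3 → V3), Continuous a₀ → Continuous θ₀ → Continuous u₀ →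
        (∀ x, 0 < a₀ x) → (∀ x, 0 < θ₀ x) →
        ∃ σ₀ : ℝ, 0 < σ₀ ∧ ∀ σ : ℝ, 0 < σ → σ < σ₀ →
          ∀ (T : ℝ) (ρ θ : ℝ → T3 → ℝ) (u : ℝ → T3 → V3), IsHardSphereEulerSolution σ T ρ u θ →
            (∀ t ∈ Ico 0 T, ∀ x, ρ t x * σ ^ 3 ≤ η₁ / 2) →
            ∀ Φ : FlowFamily σ,
              TendstoHydroFieldsAt (fun N => localGibbsLaw σ a₀ u₀ θ₀ N (Φ N)) Φ ρ u θ 0 →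
              ∀ ℓ : ℕ → ℝ, (∀ N, 0 < ℓ N ∧ ℓ N ≤ 1) → Tendsto ℓ atTop (𝓝 0) →
                Tendsto (fun N : ℕ => ℓ N ^ 3 * ((N : ℝ) + 1)) atTop atTop →
                ∀ τ ∈ Ico 0 T, ∀ a b : ℝ, a < b → ∀ φ : ℝ → T3 → ℝ,
                  Literature.Analysis.FunctionSpaces.Torus.IsSmoothSpaceTimeOn (Ico 0 T) φ →
                  (∀ t ∈ Icc 0 τ, ∀ x, 0 ≤ φ t x) →
                  Tendsto (fun N : ℕ => ∫⁻ z, ENNReal.ofReal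
                      |dynPart σ η₁ T ℓ Φ τ a b φ N z -
                        ∫ z', dynPart σ η₁ T ℓ Φ τ a b φ N z' ∂(localGibbsLaw σ a₀ u₀ θ₀ N (Φ N))|
                    ∂(localGibbsLaw σ a₀ u₀ θ₀ N (Φ N))) atTop (𝓝 0))

/-- **Registered stub `stub_entropyBalanceConcentration_of_PTBC` (S2b)** of the line `registered` of the crux
stmt-AtomisticToContinuum-9903: no anomalous entropy fluctuations (`A_N − E A_N → 0` in `L¹(P_N)`) from the positive-time
box concentration S2a. Thresholds: `ηc := η₀` of `HsEosLowDensity`, `σ₀ := min σ₀(S2a) (1/2)`. -/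
theorem stub_entropyBalanceConcentration_of_PTBC : Sig.stub_entropyBalanceConcentration_of_PTBC := by
  intro hPTBC hEos
  obtain ⟨η₀, hη₀, F, hFan, hFeq, -⟩ := hEos
  have hcont : ContinuousOn hsExcessFreeEnergy (Ico 0 η₀) :=
    (hFan.continuousOn.mono fun η hη => ⟨(neg_lt_zero.2 hη₀).trans_le hη.1, hη.2⟩).congr hFeq
  refine ⟨η₀, hη₀, fun η₁ hη₁ hη₁c a₀ θ₀ u₀ ha hθ hu ha0 hθ0 => ?_⟩
  obtain ⟨σ₁, hσ₁, H₁⟩ := hPTBC a₀ θ₀ u₀ ha hθ hu ha0 hθ0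
  refine ⟨min σ₁ (1 / 2), lt_min hσ₁ one_half_pos, ?_⟩
  intro σ hσ hσlt T ρ θ u hsol _ Φ hLLN ℓ hℓ hℓ0 hℓ3 τ hτ a b hab φ hφ _
  have H := H₁ σ hσ (hσlt.trans_le (min_le_left _ _)) T ρ θ u hsol Φ hLLN ℓ hℓ hℓ0 hℓ3
  have hP : ∀ N, IsProbabilityMeasure (localGibbsLaw σ a₀ u₀ θ₀ N (Φ N)) := fun N =>
    isProbabilityMeasure_localGibbsLaw ha hθ hu ha0 hθ0 (hσlt.trans_le (min_le_right _ _)).le N (Φ N)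
  have hgood : ∀ N, localGibbsLaw σ a₀ u₀ θ₀ N (Φ N) (Φ N).goodᶜ = 0 := fun N => by
    rw [localGibbsLaw_eq]
    exact localGibbsMeasure_absolutelyContinuous σ a₀ u₀ θ₀ N (Φ N) (Φ N).measure_compl_good
  obtain ⟨K, hK, hWK⟩ := exists_lintegral_meanKinetic_le ha hθ hu (fun x => (ha0 x).le) hθ0
  have hWK' := fun N => hWK σ N (Φ N)
  -- test data: clamped in time to `[0, τ] ⊆ [0, T)`, continuous slices, sup bounds
  have hIcc : Icc 0 τ ⊆ Ico 0 T := fun t ht => ⟨ht.1, ht.2.trans_lt hτ.2⟩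
  have hS : UniqueDiffOn ℝ (Ico 0 T) := uniqueDiffOn_Ico 0 T
  have hcl : ∀ t : ℝ, max 0 (min t τ) ∈ Icc 0 τ := fun t => ⟨le_max_left _ _, max_le hτ.1 (min_le_right _ _)⟩
  set ψ₁ : ℝ → T3 → ℝ := fun s => Torus.timeDerivWithin (Ico 0 T) φ (max 0 (min s τ)) with hψ₁
  set ψ₂ : ℝ → T3 → V3 := fun s => Torus.gradient (φ (max 0 (min s τ))) with hψ₂
  have hψ₁c : ∀ t, Continuous (ψ₁ t) := fun t => ((hφ.timeDerivWithin hS).isSmooth_slice (hIcc (hcl t))).continuous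
  have hψ₂c : ∀ t (k : Fin 3), Continuous fun x => ψ₂ t x k := fun t k =>
    (show Continuous fun m : V3 => m k by fun_prop).comp ((hφ.gradient hS).isSmooth_slice (hIcc (hcl t))).continuous
  have hφτ : Continuous (φ τ) := (hφ.isSmooth_slice (hIcc ⟨hτ.1, le_rfl⟩)).continuous
  obtain ⟨D, hD⟩ := (hφ.timeDerivWithin hS).exists_norm_le_of_isCompact isCompact_Icc hIcc
  obtain ⟨Gs, hGs⟩ := (hφ.gradient hS).exists_norm_le_of_isCompact isCompact_Icc hIcc
  have hD0 : 0 ≤ D := (norm_nonneg _).trans (hD 0 ⟨le_rfl, hτ.1⟩ 0)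
  have hGs0 : 0 ≤ Gs := (norm_nonneg _).trans (hGs 0 ⟨le_rfl, hτ.1⟩ 0)
  have hM := max_abs_pos hab
  -- the integrands
  have hZ := measurable_entG hcont hσ.le hη₁.le hη₁c a b
  have hmG := fun k => measurable_densG_momG hZ k (σ := σ) (η₁ := η₁)
  have hgr := fun k p => abs_densG_momG_le hab k p (σ := σ) (η₁ := η₁)
  -- fixed-time concentration of the pieces along the regularised flow
  have cD : ∀ t ∈ Ico 0 T, ∀ ψ : T3 → ℝ, Continuous ψ → _ := fun t ht ψ hψ =>
    conc_gflow hP hgood hℓ hK hWK' (hmG 0).1 (fun p => (hgr 0 p).1) hψ t (H t ht _ (hmG 0).1 (fun p => (hgr 0 p).1) ψ hψ)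
  have cM : ∀ t ∈ Ico 0 T, ∀ k : Fin 3, ∀ ψ : T3 → ℝ, Continuous ψ → _ := fun t ht k ψ hψ =>
    conc_gflow hP hgood hℓ hK hWK' (hmG k).2 (fun p => (hgr k p).2) hψ t (H t ht _ (hmG k).2 (fun p => (hgr k p).2) ψ hψ)
  -- the bulk `g N t z` and the boundary `k N z`
  set g : ∀ N : ℕ, ℝ → Config (N + 1) (Fin 3) T3 → ℝ := fun N t z =>
    ∫ x, statBulk σ η₁ (ℓ N) a b ψ₁ ψ₂ t (gflow (Φ N) t z) x with hg
  have hg_eq : ∀ N t z, g N t z = max |a| |b| * (∫ x, densG σ η₁ a b (fields (ℓ N) (gflow (Φ N) t z) x) * ψ₁ t x) +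
      ∑ k, max |a| |b| * ∫ x, momG σ η₁ a b k (fields (ℓ N) (gflow (Φ N) t z) x) * ψ₂ t x k := fun N t z => by
    have h1 := integrable_growth (hmG 0).1 (fun p => (hgr 0 p).1) (hψ₁c t) (hℓ N).1.le (gflow (Φ N) t z)
    have h2 := fun k => integrable_growth (hmG k).2 (fun p => (hgr k p).2) (hψ₂c t k) (hℓ N).1.le (gflow (Φ N) t z)
    simp only [hg, statBulk_eq hab (hℓ N).1.le (σ := σ) (η₁ := η₁)]
    rw [integral_add (h1.const_mul _) (integrable_finsetSum _ fun k _ => (h2 k).const_mul _), integral_const_mul,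
      integral_finsetSum _ fun k _ => (h2 k).const_mul _]
    simp only [integral_const_mul]
  -- `N`-uniform affine bound on the bulk
  have hbd : ∀ N t z, |g N t z| ≤ 3 / 2 * (max |a| |b| * D + 3 * (max |a| |b| * Gs)) +
      (max |a| |b| * D + 3 * (max |a| |b| * Gs)) / 2 * (((N : ℝ) + 1)⁻¹ * ∑ i, ‖(z i).2‖ ^ 2) := fun N t z => by
    rw [hg_eq, ← sum_norm_sq_gflow (Φ N) t z]
    have e1 := abs_integral_growth_le (hℓ N).1 (hℓ N).2 (fun p => (hgr 0 p).1) (fun x => hD _ (hcl t) x)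
      (gflow (Φ N) t z) (ψ := ψ₁ t)
    have e2 := fun k => abs_integral_growth_le (hℓ N).1 (hℓ N).2 (fun p => (hgr k p).2)
      (fun x => (PiLp.norm_apply_le (ψ₂ t x) k).trans (hGs _ (hcl t) x)) (gflow (Φ N) t z) (ψ := fun x => ψ₂ t x k)
    set W := ((N : ℝ) + 1)⁻¹ * ∑ i, ‖(gflow (Φ N) t z i).2‖ ^ 2
    have hW0 : 0 ≤ W := by positivity
    refine (abs_add_le _ _).trans ?_
    rw [abs_mul, abs_of_pos hM]
    have h3 : |∑ k, max |a| |b| * ∫ x, momG σ η₁ a b k (fields (ℓ N) (gflow (Φ N) t z) x) * ψ₂ t x k| ≤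
        ∑ k : Fin 3, max |a| |b| * (3 / 2 * Gs + Gs / 2 * W) :=
      (Finset.abs_sum_le_sum_abs _ _).trans (Finset.sum_le_sum fun k _ => by
        rw [abs_mul, abs_of_pos hM]; exact mul_le_mul_of_nonneg_left (e2 k) hM.le)
    rw [Finset.sum_const, Finset.card_univ, Fintype.card_fin, nsmul_eq_mul, Nat.cast_ofNat] at h3
    have e1' := mul_le_mul_of_nonneg_left e1 hM.le
    linarith
  -- joint measurability of the bulk in `(t, z)`
  have hgm : ∀ N, Measurable fun p : ℝ × Config (N + 1) (Fin 3) T3 => g N p.1 p.2 := fun N => by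
    have hm₁ : Measurable fun q : ℝ × T3 => ψ₁ q.1 q.2 :=
      EABirthS1a.measurable_clampTime (hφ.timeDerivWithin hS).continuousOn_stLift hτ.1 hIcc
    have hm₂ : Measurable fun q : ℝ × T3 => ψ₂ q.1 q.2 :=
      EABirthS1a.measurable_clampTime (u := fun s => Torus.gradient (φ s)) (hφ.gradient hS).continuousOn_stLift hτ.1 hIcc
    have h3 := EABirthS1a.measurable_statBulk (EABirthS1a.measurable_statEntropy (N := N) hcont hσ.le hη₁.le hη₁c
      (hℓ N).1.le a b) hm₁ hm₂
    exact ((h3.comp ((measurable_fst.comp measurable_fst).prodMk ((measurable_gflow (Φ N)).comp measurable_fst)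
      |>.prodMk measurable_snd)).stronglyMeasurable.integral_prod_right').measurable
  -- concentration of the bulk at each fixed `t ∈ (0, τ]`
  have hconc : ∀ t ∈ Ioc 0 τ, Tendsto (fun N : ℕ => ∫⁻ z, ENNReal.ofReal
      |g N t z - ∫ z', g N t z' ∂(localGibbsLaw σ a₀ u₀ θ₀ N (Φ N))| ∂(localGibbsLaw σ a₀ u₀ θ₀ N (Φ N)))
      atTop (𝓝 0) := by
    intro t ht
    have ht' : t ∈ Ico 0 T := ⟨ht.1.le, ht.2.trans_lt hτ.2⟩
    have c1 := cD t ht' (ψ₁ t) (hψ₁c t)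
    have c2 := fun k => cM t ht' k (fun x => ψ₂ t x k) (hψ₂c t k)
    have h := tendsto_conc_add (fun N => localGibbsLaw σ a₀ u₀ θ₀ N (Φ N))
      (fun N => (c1.1 N).const_mul (max |a| |b|))
      (fun N => integrable_finsetSum _ fun k _ => ((c2 k).1 N).const_mul (max |a| |b|))
      (tendsto_conc_const_mul _ _ c1.2)
      (tendsto_conc_finsetSum _ Finset.univ (fun k _ N => ((c2 k).1 N).const_mul (max |a| |b|))
        fun k _ => tendsto_conc_const_mul _ _ (c2 k).2)
    refine h.congr fun N => ?_
    simp only [hg_eq]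
  -- the time integral concentrates
  obtain ⟨hint, hbulk⟩ := tendsto_conc_integral (fun N => localGibbsLaw σ a₀ u₀ θ₀ N (Φ N)) hP
    (volume.restrict (Ioc 0 τ)) (g := g) hgm (fun N => by fun_prop) (fun N z => by positivity) hWK'
    (by positivity) (by positivity) hK hbd (ae_restrict_of_forall_mem measurableSet_Ioc hconc)
  -- the boundary term
  have cB := cD τ ⟨hτ.1, hτ.2⟩ (φ τ) hφτ
  have hk_eq : ∀ N z, ∫ x, statBdry σ η₁ (ℓ N) a b (φ τ) (gflow (Φ N) τ z) x =
      max |a| |b| * ∫ x, densG σ η₁ a b (fields (ℓ N) (gflow (Φ N) τ z) x) * φ τ x := fun N z => by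
    simp only [statBdry_eq hab (hℓ N).1.le (σ := σ) (η₁ := η₁), integral_const_mul]
  have hbdry := tendsto_conc_const_mul _ (-max |a| |b|) cB.2
  -- assembly: `A_N = ∫ g_N dt + (−k_N)` almost surely
  have hfin := tendsto_conc_add (fun N => localGibbsLaw σ a₀ u₀ θ₀ N (Φ N)) hint
    (fun N => (cB.1 N).const_mul (-max |a| |b|)) hbulk hbdry
  refine tendsto_conc_congr_ae (fun N => localGibbsLaw σ a₀ u₀ θ₀ N (Φ N)) (fun N => ?_) hfin
  filter_upwards [gflow_ae_eq (Φ N) (hgood N)] with z hz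
  rw [EABirthS1a.dynPart_eq_clamp]
  simp only [← hz, hk_eq, hg, neg_mul, ← sub_eq_add_neg]
  rfl

end Summit.AtomisticToContinuum.HydrodynamicLimit.Theorems.EABirthS2b

end
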